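import Summits.Ventures.LatticeQCDFlow.Scaling.BooleanStarPoolEstimates

/-!
HONEST FRAMING: exact (Metropolis-corrected) sampling algorithms for lattice gauge theory; figures
of merit are autocorrelation/cost numbers at stated couplings and volumes; no continuum-physics
claim.

# BooleanStarPoolRegime — THE LAST CORNER OF OPEN-MATH ITEM 1 (ii) ON THE HOMOGENEOUS BOOLEAN STAR, CONCRETE HALF (2/2): THE CLOSED-FORM CONDITIONS (Q0), (Q2a),
# (Q2b), (Q2c) OF THE RELATIVE-DRIFT POTENTIAL IN THE MACROSCOPIC-POOL REGIME `μ_0(b̄)·rr·K ≥ μ_0(b)/2` (AND `rr ≤ μ_0(b)` FOR Q0), WITH `ρ = μ_0(b)c/(96(h+2t))`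
# (lean-2 GEN-33, ours)

Venture-side (OURS).  Cell `lqcd-flow` (pub-lqcd), unit `pub-lqcd-lean-2-g33`, 2026-08-29.  Chapter T, file 2b, on top of `BooleanStarPoolEstimates` (T2a: the
one-copy chain of S9/S11 on the integers — `q↓(z) = μ_0(b)π_b(z)`, `q↑(z) = μ_0(b̄)π_b̄(z)`, `m = q↑ − q↓`, `π_b(B) = cB/Δ(B)`, `π_b̄(B) = c·rr(K−B)/Δ(B+1)`,
`Δ(B) = h + cB + c·rr(K−B+1)`, `t = cK`).  This file verifies, by real arithmetic on the closed forms of S11, the four quantitative hypotheses that the abstract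
budget theorem of T1/T1b (`oneCopyDrift_of_relativeDriftPotential`, `β = 1/6`) asks of the chain:

* **`pool_Q0`** — `rr ≤ μ_0(b)` and `m(B₀+1) < 0` ⇒ `q↑(B₀) ≤ 3q↓(B₀+1)` (`β·q↑(B₀) ≤ q↓(B₀+1)/2`): from `q↑(B₀+1) < q↓(B₀+1)` and `Δ(B₀+2) ≤ 2Δ(B₀+1)` one gets
  `μ̄rr(K−B₀−1) < 2μ(B₀+1)`, and `μ̄rr ≤ rr ≤ μ`.  (The only place where `rr ≤ μ_0(b)` enters; for `rr ≥ μ_0(b)` the defect-count rate of T0 is already of the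
  conjectured order.)
* **`pool_Q2a`** — `μ_0(b)+μ_0(b̄) = 1`, `μ_0(b̄)rrK ≥ μ_0(b)/2` ⇒ `g(z) ≥ μ_0(b)c/(12(h+2t)) = 8ρ` for `0 ≤ z ≤ min{K−1, 2μ_0(b̄)rrK/μ_0(b)}`:
  `g ≥ c(ph + rr(t+c))/(Δ(z+1)Δ(z+2))`, `μ_0(b)Δ(z+1) ≤ 4(ph + rr(t+c))` on the pool zone (`μ_0(b)c ≤ 2rr·t`), `Δ(z+2) ≤ 2(h+2t)`.
* **`pool_Q2b`** — beyond `2μ_0(b̄)rrK/μ_0(b)`: `|m(z)| ≥ μ_0(b)cz/(2Δ(z))`, `q↓(z+1) − q↑(z) ≥ |m(z)|`, `Δ(z) ≤ min{Δ(z+1), h+2t}`, hence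
  `2ρz·q↓(z+1) ≤ (1/6)|m(z)|(q↓(z+1) − q↑(z))`.
* **`pool_Q2c`** — `2ρK ≤ (1/6)|m(K)|` (`|m(K)| = q↓(K) ≥ μ_0(b)t/(h+2t)`).

So with `β = 1/6`, `Bp = ⌊2μ_0(b̄)rrK/μ_0(b)⌋`, `ρ = μ_0(b)c/(96(h+2t))` all of (Q0), (Q2a–c) hold in the regime `rr ≤ μ_0(b)`, `μ_0(b̄)rrK ≥ μ_0(b)/2`; the assembly
(potential on `ℤ`, McShane, S11 `boolStar_mixingTime_le_of_oneCopyDrift_int`) is T3.  Toy value (work-gen33/numerics/explicit_potential.py; NOTHING CLAIMED): the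
inequality itself holds with `κ ≥ 0.75` in these units; `1/96` is what the crude bounds certify.
NOT CLAIMED: anything measured; optimal constants.  Literature grade (cell rule): OWN, elementary; nothing cited as a fact; no new bib keys.
-/

noncomputable section

namespace Summit.Ventures.LatticeQCDFlow.Scaling

/-! ## §2 The regime `rr ≤ μ_0(b)`, `μ_0(b̄)·rr·K ≥ μ_0(b)/2`: (Q0), (Q2a), (Q2b), (Q2c) -/

section Regime

variable {h c t rr μb μb' : ℝ} {K : ℕ} {qd qu m : ℤ → ℝ}

/-- **(Q0): the loss at the bottom is affordable** — `q↑(B₀) ≤ 3q↓(B₀+1)` (i.e. `β·q↑(B₀) ≤ q↓(B₀+1)/2` with `β = 1/6`) whenever `m(B₀+1) < 0` and `rr ≤ μ_0(b)`: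
from `q↑(B₀+1) < q↓(B₀+1)`, `Δ(B₀+2) ≤ 2Δ(B₀+1)` one gets `μ̄rr(K−B₀−1) < 2μ(B₀+1)`, and `μ̄rr ≤ rr ≤ μ ≤ μ(B₀+1)`. [ours] -/
theorem pool_Q0 (hh : 0 < h) (hc : 0 < c) (hrr0 : 0 ≤ rr) (hμb : 0 < μb) (hμb'1 : μb' ≤ 1) (hrrμ : rr ≤ μb)
    (hqd : ∀ z : ℤ, qd z = μb * (c * z / (h + c * z + c * rr * ((K : ℝ) - z + 1))))
    (hqu : ∀ z : ℤ, qu z = μb' * (c * ((K : ℝ) - z) * rr / (h + c * ((K : ℝ) - z) * rr + c * (z + 1))))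
    (hm : ∀ z, m z = qu z - qd z) {B₀ : ℤ} (hB0 : 0 ≤ B₀) (hB0K : B₀ + 1 ≤ K) (hmB1 : m (B₀ + 1) < 0) :
    1 / 6 * qu B₀ ≤ qd (B₀ + 1) / 2 := by
  have h0 : (0 : ℝ) ≤ B₀ := by exact_mod_cast hB0
  have hK : (B₀ : ℝ) + 1 ≤ K := by exact_mod_cast hB0K
  -- denominators: `D1 = Δ(B₀+1)` (shared by `q↑(B₀)` and `q↓(B₀+1)`) and `D2 = Δ(B₀+2)`
  set D1 := h + c * ((B₀ : ℝ) + 1) + c * rr * (K - ((B₀ : ℝ) + 1) + 1) with hD1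
  set D2 := h + c * ((B₀ : ℝ) + 1 + 1) + c * rr * (K - ((B₀ : ℝ) + 1 + 1) + 1) with hD2
  have d1 : 0 < D1 := oneCopy_den_pos hh hc.le hrr0 (by linarith) (by linarith)
  have d2 : 0 < D2 := oneCopy_den_pos hh hc.le hrr0 (by linarith) (by linarith)
  -- closed forms
  have equ0 : qu B₀ = μb' * c * ((K : ℝ) - B₀) * rr / D1 := by
    rw [hqu, hD1]; rw [show h + c * ((K : ℝ) - B₀) * rr + c * ((B₀ : ℝ) + 1) = h + c * ((B₀ : ℝ) + 1) + c * rr * (K - ((B₀ : ℝ) + 1) + 1) by ring]; ring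
  have eqd1 : qd (B₀ + 1) = μb * c * ((B₀ : ℝ) + 1) / D1 := by rw [hqd, hD1]; push_cast; ring
  have equ1 : qu (B₀ + 1) = μb' * c * ((K : ℝ) - (B₀ + 1)) * rr / D2 := by
    rw [hqu, hD2]; push_cast
    rw [show h + c * ((K : ℝ) - (B₀ + 1)) * rr + c * ((B₀ : ℝ) + 1 + 1) = h + c * ((B₀ : ℝ) + 1 + 1) + c * rr * (K - ((B₀ : ℝ) + 1 + 1) + 1) by ring]; ring
  -- `Δ(B₀+1) ≥ c` and `Δ(B₀+2) ≤ 2Δ(B₀+1)`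
  have n0 : 0 ≤ c * rr * ((K : ℝ) - ((B₀ : ℝ) + 1) + 1) := mul_nonneg (mul_nonneg hc.le hrr0) (by linarith)
  have dc : c ≤ D1 := by rw [hD1]; nlinarith
  have d12 : D2 ≤ 2 * D1 := by
    have : D2 = D1 + c * (1 - rr) := by rw [hD1, hD2]; ring
    rw [this]; nlinarith
  -- unpack `m(B₀+1) < 0`: `μ̄ c (K − B₀ − 1) rr · D1 < μ c (B₀+1) · D2 ≤ 2 μ c (B₀+1) D1`
  rw [hm, equ1, eqd1, sub_neg, div_lt_div_iff₀ d2 d1] at hmB1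
  have step : μb' * rr * ((K : ℝ) - (B₀ + 1)) < 2 * (μb * ((B₀ : ℝ) + 1)) := by
    have a := lt_of_lt_of_le hmB1 (mul_le_mul_of_nonneg_left d12 (by positivity))
    -- divide by `c · D1 > 0`
    have b : (μb' * rr * ((K : ℝ) - (B₀ + 1))) * (c * D1) < (2 * (μb * ((B₀ : ℝ) + 1))) * (c * D1) := by linarith
    exact lt_of_mul_lt_mul_right b (by positivity)
  -- `μ̄ rr ≤ μ ≤ μ(B₀+1)`
  have small : μb' * rr ≤ μb * ((B₀ : ℝ) + 1) := by
    have : μb' * rr ≤ 1 * rr := mul_le_mul_of_nonneg_right hμb'1 hrr0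
    nlinarith
  -- the claim: `(1/6) μ̄ c (K − B₀) rr ≤ μ c (B₀+1)/2`, both over `D1`
  have num : 1 / 6 * (μb' * c * ((K : ℝ) - B₀) * rr) ≤ μb * c * ((B₀ : ℝ) + 1) / 2 := by
    have : μb' * rr * ((K : ℝ) - B₀) ≤ 3 * (μb * ((B₀ : ℝ) + 1)) := by linarith
    have := mul_le_mul_of_nonneg_left this hc.le
    linarith
  rw [equ0, eqd1]
  calc 1 / 6 * (μb' * c * ((K : ℝ) - B₀) * rr / D1) = 1 / 6 * (μb' * c * ((K : ℝ) - B₀) * rr) / D1 := by ring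
    _ ≤ (μb * c * ((B₀ : ℝ) + 1) / 2) / D1 := div_le_div_of_nonneg_right num d1.le
    _ = μb * c * ((B₀ : ℝ) + 1) / D1 / 2 := by ring

/-- **(Q2a): THE GAP IS `≥ 8ρ` ACROSS THE POOL ZONE.**  With `μ_0(b) + μ_0(b̄) = 1` and `μ_0(b̄)·rr·K ≥ μ_0(b)/2` (no other hypothesis), for every integer
`0 ≤ z ≤ K−1` with `z ≤ 2μ_0(b̄)rrK/μ_0(b)`: **`m(z) − m(z+1) ≥ 8ρ = μ_0(b)c/(12(h+2t))`** (`ρ = μ_0(b)c/(96(h+2t))`).  From S11's closed form,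
`g(z) ≥ c(ph + rr(t+c))/(Δ(z+1)Δ(z+2))` (`p = μ_0(b) + μ_0(b̄)rr`), and on the pool zone `μ_0(b)Δ(z+1) ≤ μ_0(b)(h + rr t + c) + 2μ_0(b̄)rr t ≤ 4(ph + rr(t+c))`
(`μ_0(b)c ≤ 2rr·t`), `Δ(z+2) ≤ 2(h+2t)`; hence `μ_0(b)Δ(z+1)Δ(z+2) ≤ 8(ph + rr(t+c))(h+2t)`. [ours] -/
theorem pool_Q2a (hh : 0 < h) (hc : 0 < c) (hct : c ≤ t) (htK : t = c * K) (hrr0 : 0 ≤ rr) (hrr1 : rr ≤ 1) (hμb : 0 < μb) (hμb' : 0 ≤ μb')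
    (hsum : μb + μb' = 1) (hpool : μb / 2 ≤ μb' * rr * K)
    (hqd : ∀ z : ℤ, qd z = μb * (c * z / (h + c * z + c * rr * ((K : ℝ) - z + 1))))
    (hqu : ∀ z : ℤ, qu z = μb' * (c * ((K : ℝ) - z) * rr / (h + c * ((K : ℝ) - z) * rr + c * (z + 1))))
    (hm : ∀ z, m z = qu z - qd z) (z : ℤ) (hz : 0 ≤ z) (hzW : (z : ℝ) ≤ 2 * μb' * rr * K / μb) (hzK : z + 1 ≤ K) :
    8 * (μb * c / (96 * (h + 2 * t))) ≤ m z - m (z + 1) := by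
  have hz' : (0 : ℝ) ≤ z := by exact_mod_cast hz
  have hzK' : (z : ℝ) + 1 ≤ K := by exact_mod_cast hzK
  have ht0 : 0 < t := lt_of_lt_of_le hc hct
  have hS : 0 < h + 2 * t := by linarith
  have hSne : h + 2 * t ≠ 0 := hS.ne'
  rw [show 8 * (μb * c / (96 * (h + 2 * t))) = μb * c / (12 * (h + 2 * t)) by field_simp; ring]
  have hK0 : (0 : ℝ) ≤ K := by linarith
  -- S11's closed form of the gap at `B = z`
  have g := oneCopy_gap_eq (K := (K : ℝ)) (πb := fun B : ℝ => c * B / (h + c * B + c * rr * ((K : ℝ) - B + 1)))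
    (πb' := fun B : ℝ => c * ((K : ℝ) - B) * rr / (h + c * ((K : ℝ) - B) * rr + c * (B + 1)))
    (m := fun B : ℝ => μb' * (c * ((K : ℝ) - B) * rr / (h + c * ((K : ℝ) - B) * rr + c * (B + 1))) - μb * (c * B / (h + c * B + c * rr * ((K : ℝ) - B + 1))))
    (B := (z : ℝ)) (fun B => rfl) (fun B => rfl) (fun B => rfl) hh hc.le hrr0 hz' hzK'
  -- the three denominators `Δ(z) ≤ Δ(z+1) ≤ Δ(z+2)`
  set D0 := h + c * (z : ℝ) + c * rr * (K - z + 1) with hD0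
  set D1 := h + c * ((z : ℝ) + 1) + c * rr * (K - ((z : ℝ) + 1) + 1) with hD1
  set D2 := h + c * ((z : ℝ) + 2) + c * rr * (K - ((z : ℝ) + 2) + 1) with hD2
  have d0 : 0 < D0 := oneCopy_den_pos hh hc.le hrr0 hz' (by linarith)
  have d1 : 0 < D1 := oneCopy_den_pos hh hc.le hrr0 (by linarith) (by linarith)
  have d2 : 0 < D2 := oneCopy_den_pos hh hc.le hrr0 (by linarith) (by linarith)
  have c1 : 0 ≤ c * (1 - rr) := mul_nonneg hc.le (by linarith)
  have e01 : D1 = D0 + c * (1 - rr) := by rw [hD0, hD1]; ring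
  have e12 : D2 = D1 + c * (1 - rr) := by rw [hD1, hD2]; ring
  have m01 : D0 ≤ D1 := by rw [e01]; linarith
  have m02 : D0 ≤ D2 := by rw [e12, e01]; linarith
  -- rewrite the goal with the closed form
  rw [hm, hm, hqu, hqu, hqd, hqd]; push_cast
  rw [g]
  -- the first term only loses by `D0 D1 ≤ D1 D2`
  have n1 : 0 ≤ c * (h + c * rr * ((K : ℝ) + 1)) := by positivity
  have l1 : μb * (c * (h + c * rr * ((K : ℝ) + 1)) / (D1 * D2)) ≤ μb * (c * (h + c * rr * ((K : ℝ) + 1)) / (D0 * D1)) := by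
    have : D0 * D1 ≤ D1 * D2 := by have := mul_le_mul_of_nonneg_right m02 d1.le; linarith
    exact mul_le_mul_of_nonneg_left (div_le_div_of_nonneg_left n1 (mul_pos d0 d1) this) hμb.le
  -- the bound with the common denominator `D1 D2`: `μ c · D1 D2 ≤ 12 c N' (h + 2t)`
  set N' := (μb + μb' * rr) * h + rr * t + rr * c with hN'
  have N'pos : 0 ≤ N' := by rw [hN']; positivity
  have Neq : μb * (c * (h + c * rr * ((K : ℝ) + 1))) + μb' * (c * rr * (h + c * ((K : ℝ) + 1))) = c * N' := by
    rw [hN', htK]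
    linear_combination (c ^ 2 * rr * ((K : ℝ) + 1)) * hsum
  have key : μb * c / (12 * (h + 2 * t)) ≤ (c * N') / (D1 * D2) := by
    rw [div_le_div_iff₀ (by positivity) (mul_pos d1 d2)]
    -- pool-zone bounds on `D1`, `D2`
    have htK' : rr * t = c * rr * K := by rw [htK]; ring
    have czW : μb * (c * (z : ℝ)) ≤ 2 * μb' * (rr * t) := by
      have := mul_le_mul_of_nonneg_left hzW hc.le
      have e : c * (2 * μb' * rr * K / μb) * μb = 2 * μb' * (c * rr * K) := by field_simp
      have := mul_le_mul_of_nonneg_right this hμb.le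
      rw [e, ← htK'] at this; linarith
    have nz : 0 ≤ c * rr * (z : ℝ) := by positivity
    have crr : 0 ≤ c * rr := by positivity
    -- `μ·D1 ≤ μ(h + rr t + c) + 2μ̄ rr t =: M1`, `μ·D2 ≤ M1 + μc`
    have M1 : μb * D1 ≤ μb * h + μb * (rr * t) + μb * c + 2 * μb' * (rr * t) := by
      have x : D1 ≤ h + c * z + c + rr * t := by rw [hD1, htK']; linarith
      have := mul_le_mul_of_nonneg_left x hμb.le
      linarith
    have M2 : μb * D2 ≤ μb * h + μb * (rr * t) + 2 * (μb * c) + 2 * μb' * (rr * t) := by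
      have x : D2 ≤ h + c * z + 2 * c + rr * t := by rw [hD2, htK']; linarith
      have := mul_le_mul_of_nonneg_left x hμb.le
      linarith
    -- `M1 + μc ≤ 2N' + 2μc ≤ 2N' + 4 rr t ≤ 6N'`... we use: `μh ≤ 2ph`, `(μ + 2μ̄) rr t ≤ 2 rr t`, `μ c ≤ 2 rr t ≤ 2N'`
    have hμb1 : μb ≤ 1 := by linarith
    have hμb'1 : μb' ≤ 1 := by linarith
    have y1 : μb * (rr * t) + 2 * μb' * (rr * t) ≤ 2 * (rr * t) := by
      have := mul_nonneg (by linarith : 0 ≤ 2 - μb - 2 * μb') (mul_nonneg hrr0 ht0.le); linarith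
    have y2 : μb * c ≤ 2 * (rr * t) := by
      have a : μb' * rr * K ≤ rr * K := by
        have := mul_nonneg (mul_nonneg (by linarith : 0 ≤ 1 - μb') hrr0) hK0; linarith
      have := mul_le_mul_of_nonneg_left (le_trans hpool a) hc.le
      rw [htK']; linarith
    have y3 : 0 ≤ μb' * rr * h := by positivity
    have y4 : 0 ≤ μb * h := by positivity
    have y5 : 0 ≤ rr * c := by positivity
    have Mle : μb * h + μb * (rr * t) + μb * c + 2 * μb' * (rr * t) ≤ 4 * N' := by rw [hN']; linarith
    have M2le : μb * h + μb * (rr * t) + 2 * (μb * c) + 2 * μb' * (rr * t) ≤ 6 * N' := by rw [hN']; linarith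
    -- `D1 ≤ h + 2t`, `D2 ≤ ?`: we only need `D2 ≤ 2(h + 2t)`
    have D2S : D2 ≤ 2 * (h + 2 * t) := by
      have hcK : c ≤ c * K := by rw [← htK]; exact hct
      rw [hD2, htK]
      have a1 : c * rr * ((K : ℝ) - ((z : ℝ) + 2) + 1) ≤ c * 1 * K :=
        mul_le_mul (mul_le_mul_of_nonneg_left hrr1 hc.le) (by linarith : (K : ℝ) - ((z : ℝ) + 2) + 1 ≤ K) (by linarith) (by positivity)
      have a2 := mul_le_mul_of_nonneg_left hzK' hc.le
      linarith
    -- assemble: `μ c D1 D2 = c (μ D1) D2 ≤ c · 4N' · D2`?  Better: `μ D1 D2 ≤ (μ D1) D2 ≤ 4N' · 2(h+2t) = 8 N'(h+2t) ≤ 12 N'(h+2t)`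
    have P : μb * (D1 * D2) ≤ 8 * N' * (h + 2 * t) := by
      have := mul_le_mul (le_trans M1 Mle) D2S d2.le (by positivity)
      linarith
    have f1 := mul_le_mul_of_nonneg_left P hc.le
    have f2 : 0 ≤ c * (N' * (h + 2 * t)) := by positivity
    linarith
  calc μb * c / (12 * (h + 2 * t)) ≤ (c * N') / (D1 * D2) := key
    _ = μb * (c * (h + c * rr * ((K : ℝ) + 1)) / (D1 * D2)) + μb' * (c * rr * (h + c * ((K : ℝ) + 1)) / (D1 * D2)) := by rw [← Neq]; ring
    _ ≤ μb * (c * (h + c * rr * ((K : ℝ) + 1)) / (D0 * D1)) + μb' * (c * rr * (h + c * ((K : ℝ) + 1)) / (D1 * D2)) := by linarith [l1]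

/-- **(Q2b): BEYOND THE POOL ZONE THE SURPLUS DOMINATES.**  For an integer `z ≥ 1` with `z > 2μ_0(b̄)rrK/μ_0(b)` and `z ≤ K−1`: `|m(z)| ≥ μ_0(b)cz/(2Δ(z))`,
`q↓(z+1) − q↑(z) ≥ |m(z)|`, `Δ(z) ≤ min{Δ(z+1), h+2t}`, hence **`2ρz·q↓(z+1) ≤ (1/6)|m(z)|(q↓(z+1) − q↑(z))`** with `ρ = μ_0(b)c/(96(h+2t))`. [ours] -/
theorem pool_Q2b (hh : 0 < h) (hc : 0 < c) (hct : c ≤ t) (htK : t = c * K) (hrr0 : 0 ≤ rr) (hrr1 : rr ≤ 1) (hμb : 0 < μb) (hμb' : 0 ≤ μb')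
    (hqd : ∀ z : ℤ, qd z = μb * (c * z / (h + c * z + c * rr * ((K : ℝ) - z + 1))))
    (hqu : ∀ z : ℤ, qu z = μb' * (c * ((K : ℝ) - z) * rr / (h + c * ((K : ℝ) - z) * rr + c * (z + 1))))
    (hm : ∀ z, m z = qu z - qd z) (z : ℤ) (hz : 1 ≤ z) (hzW : 2 * μb' * rr * K / μb < (z : ℝ)) (hzK : z + 1 ≤ K) :
    2 * (μb * c / (96 * (h + 2 * t))) * z * qd (z + 1) ≤ 1 / 6 * (-m z) * (qd (z + 1) - qu z) := by
  have hz' : (1 : ℝ) ≤ z := by exact_mod_cast hz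
  have hzK' : (z : ℝ) + 1 ≤ K := by exact_mod_cast hzK
  have ht0 : 0 < t := lt_of_lt_of_le hc hct
  have hS : 0 < h + 2 * t := by linarith
  set D0 := h + c * (z : ℝ) + c * rr * (K - z + 1) with hD0
  set D1 := h + c * ((z : ℝ) + 1) + c * rr * (K - (z + 1) + 1) with hD1
  have d0 : 0 < D0 := oneCopy_den_pos hh hc.le hrr0 (by linarith) (by linarith)
  have d1 : 0 < D1 := oneCopy_den_pos hh hc.le hrr0 (by linarith) (by linarith)
  have m01 : D0 ≤ D1 := by rw [hD0, hD1]; nlinarith [mul_nonneg hc.le (by linarith : (0:ℝ) ≤ 1 - rr)]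
  have d0S : D0 ≤ h + 2 * t := by
    rw [hD0]
    have : c * rr * ((K : ℝ) - z + 1) ≤ c * 1 * ((K : ℝ) - z + 1) := mul_le_mul_of_nonneg_right (mul_le_mul_of_nonneg_left hrr1 hc.le) (by linarith)
    rw [htK]; nlinarith
  have equ : h + c * ((K : ℝ) - z) * rr + c * ((z : ℝ) + 1) = D1 := by rw [hD1]; ring
  -- the closed forms
  have eqd : qd z = μb * c * z / D0 := by rw [hqd]; ring
  have eqd1 : qd (z + 1) = μb * c * (z + 1) / D1 := by rw [hqd]; push_cast; rw [← hD1]; ring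
  have equ' : qu z = μb' * c * ((K : ℝ) - z) * rr / D1 := by rw [hqu, equ]; ring
  -- `μ̄ rr K < μ z/2`
  have pool : 2 * μb' * rr * K < μb * z := by have := (div_lt_iff₀ hμb).mp hzW; linarith
  -- `|m(z)| ≥ μ c z/(2 D0)`
  have mlow : μb * c * z / (2 * D0) ≤ -m z := by
    rw [hm, eqd, equ']
    have a : μb' * c * ((K : ℝ) - z) * rr / D1 ≤ μb' * c * rr * K / D0 := by
      calc μb' * c * ((K : ℝ) - z) * rr / D1 ≤ μb' * c * ((K : ℝ) - z) * rr / D0 :=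
            div_le_div_of_nonneg_left (mul_nonneg (mul_nonneg (mul_nonneg hμb' hc.le) (by linarith)) hrr0) d0 m01
        _ ≤ μb' * c * rr * K / D0 := div_le_div_of_nonneg_right (by nlinarith [mul_nonneg (mul_nonneg hμb' hc.le) hrr0]) d0.le
    have b : μb * c * z / (2 * D0) ≤ μb * c * z / D0 - μb' * c * rr * K / D0 := by
      rw [div_sub_div_same, div_le_div_iff₀ (by positivity) d0]
      have p0 : μb' * c * rr * K ≤ μb * c * z / 2 := by have := mul_le_mul_of_nonneg_left pool.le hc.le; linarith
      have p1 := mul_le_mul_of_nonneg_left p0 (by linarith : 0 ≤ 2 * D0)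
      linarith
    linarith
  have mpos : 0 ≤ μb * c * z / (2 * D0) := by positivity
  -- `q↓(z+1) − q↑(z) ≥ |m(z)|`
  have gap : -m z ≤ qd (z + 1) - qu z := by
    rw [hm]
    have := pool_qd_mono (K := K) hh hc hrr0 hμb hqd z (by linarith) hzK
    linarith
  have rhs : 1 / 6 * (μb * c * z / (2 * D0)) * (μb * c * z / (2 * D0)) ≤ 1 / 6 * (-m z) * (qd (z + 1) - qu z) := by
    have := mul_le_mul mlow (le_trans mlow gap) mpos (le_trans mpos mlow)
    linarith
  -- `LHS ≤ 2ρz · μc(2z)/D0 = (1/6)(μcz/(2(h+2t)))(μcz/(2D0)) ≤ (1/6)(μcz/(2D0))²`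
  have lhs : 2 * (μb * c / (96 * (h + 2 * t))) * z * qd (z + 1) ≤ 1 / 6 * (μb * c * z / (2 * D0)) * (μb * c * z / (2 * D0)) := by
    have A1 : qd (z + 1) ≤ 2 * (μb * c * z) / D0 := by
      rw [eqd1]
      calc μb * c * ((z : ℝ) + 1) / D1 ≤ 2 * (μb * c * z) / D1 := div_le_div_of_nonneg_right (by nlinarith [mul_pos hμb hc]) d1.le
        _ ≤ 2 * (μb * c * z) / D0 := div_le_div_of_nonneg_left (by positivity) d0 m01
    have ρz : 0 ≤ 2 * (μb * c / (96 * (h + 2 * t))) * z := by positivity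
    have B1 := mul_le_mul_of_nonneg_left A1 ρz
    have hSne : h + 2 * t ≠ 0 := hS.ne'
    have hD0ne : D0 ≠ 0 := d0.ne'
    have B2 : 2 * (μb * c / (96 * (h + 2 * t))) * z * (2 * (μb * c * z) / D0) = 1 / 6 * (μb * c * z / (2 * (h + 2 * t))) * (μb * c * z / (2 * D0)) := by
      field_simp
      ring
    have B3 : μb * c * z / (2 * (h + 2 * t)) ≤ μb * c * z / (2 * D0) := div_le_div_of_nonneg_left (by positivity) (by positivity) (by linarith)
    have B4 := mul_le_mul_of_nonneg_left B3 (by positivity : 0 ≤ 1 / 6 * (μb * c * z / (2 * D0)))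
    linarith [B1, B2, B3, B4]
  exact le_trans lhs rhs

/-- **(Q2c): at the top** `2ρK ≤ (1/6)|m(K)|` (`|m(K)| = q↓(K) = μ_0(b)t/Δ(K) ≥ μ_0(b)t/(h+2t)`, `2ρK = μ_0(b)t/(48(h+2t))`). [ours] -/
theorem pool_Q2c (hh : 0 < h) (hc : 0 < c) (hct : c ≤ t) (htK : t = c * K) (hrr0 : 0 ≤ rr) (hrr1 : rr ≤ 1) (hμb : 0 < μb)
    (hqd : ∀ z : ℤ, qd z = μb * (c * z / (h + c * z + c * rr * ((K : ℝ) - z + 1))))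
    (hqu : ∀ z : ℤ, qu z = μb' * (c * ((K : ℝ) - z) * rr / (h + c * ((K : ℝ) - z) * rr + c * (z + 1))))
    (hm : ∀ z, m z = qu z - qd z) :
    2 * (μb * c / (96 * (h + 2 * t))) * K ≤ 1 / 6 * (-m K) := by
  have ht0 : 0 < t := lt_of_lt_of_le hc hct
  have hS : 0 < h + 2 * t := by linarith
  rw [hm, pool_qu_top hqu, hqd]; push_cast
  have crr : 0 ≤ c * rr := by positivity
  have hD : 0 < h + c * (K : ℝ) + c * rr * (K - K + 1) := by nlinarith
  have hDS : h + c * (K : ℝ) + c * rr * (K - K + 1) ≤ h + 2 * t := by rw [htK]; nlinarith [mul_le_mul_of_nonneg_left hrr1 hc.le]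
  have hSne : h + 2 * t ≠ 0 := hS.ne'
  have hDne : h + c * (K : ℝ) + c * rr * (K - K + 1) ≠ 0 := hD.ne'
  rw [show 2 * (μb * c / (96 * (h + 2 * t))) * (K : ℝ) = μb * (c * K) / 48 / (h + 2 * t) by field_simp; ring,
    show 1 / 6 * -(0 - μb * (c * (K : ℝ) / (h + c * K + c * rr * (K - K + 1)))) = μb * (c * K) / 6 / (h + c * K + c * rr * (K - K + 1)) by
      field_simp; ring]
  have hX : 0 ≤ μb * (c * (K : ℝ)) := by positivity
  calc μb * (c * K) / 48 / (h + 2 * t) ≤ μb * (c * K) / 6 / (h + 2 * t) :=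
        div_le_div_of_nonneg_right (div_le_div_of_nonneg_left hX (by norm_num) (by norm_num)) hS.le
    _ ≤ μb * (c * K) / 6 / (h + c * K + c * rr * (K - K + 1)) := div_le_div_of_nonneg_left (by positivity) hD hDS

end Regime

end Summit.Ventures.LatticeQCDFlow.Scaling

end
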